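import Summits.QuantumFields.YangMills.Theorems.BalabanUVNodesPortZDResidueW
import Summits.QuantumFields.YangMills.Theses.BalabanUVNodes

/-!
# `PortZeroInputSplitZD` ⟨stmt-QuantumFields-26648⟩ — LINE-FIRST SKELETON `port_zero_input_split_zd` (line-writer seat `linewriter-ym-nodeo-1` g0, operator priority28, 2026-08-31)
# route `route-QuantumFields-BalabanUVNodes` (rev 38) · support item (rank 9; signed text v4Ax-LR4 sha16 `2e9a851246ef134f`, 18 438 ch, checked_at 2026-08-31T00:55:25Z)

THE ITEM AS THE CRUX CONSUMES IT.  ⟨26648⟩ is the ZERO-INPUT∕HISTORY split of the port row ⟨27930⟩ `PortRecordRepresentationS1`: under the shared port antecedent (guards, [15] Thm 1 package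
`VariationalThm1RegSepCoP7MGB`, `Gauge9RegSepTopStepGB`, the E ∧ U clause on `PlaqSmall`, background-field analyticity at `thetaFill`, the `H`-decay clause) it asks for ONE tuple of constants
`γ₀ ε₂₉ σ ρ Ē κ α₀ α₁` (nine guard clauses) such that along every guarded RG history `g` (`FlowStep.RGEqH k (betaOfRecord₁₃Ax …) g`, `Step.InInterval γ₀ k g`):
(Z) the ZERO-INPUT pieces `recordΦzAx` are in the signed format `B12FormatPlus.FormatPlusG … σ κ` ([Balaban1987RG1] Thm 3 at input `𝐄_k := 0`: the «terms from log Z^{(k)}», absolute constant),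
(L) for every input scale `0 < E ≤ Ē`, the formats `E` of the full pieces `recordΦfAx` at all earlier steps `k₁ < k` of the same history imply the format `ρ·E` of the DIFFERENCE
`recordΦfAx − recordΦzAx` at `k` ([Balaban1988RG2Cluster] Lemma 3 (2.38) p.20–21: the history channel contracts).
THE LINE = THE TREE's ONE-OBJECT ROAD (PTZ-1 g3, `Theorems/BalabanUVNodesPortZDResidueW`, sorry-free): the signed text follows BY NAME from its WRAP-AWARE RESIDUE FORM through
`PortZDSplit.sig26648LR4_of_zeroInputInductiveStepW` — per guarded `(k, g)`, TERMS `Ψ : IntLocalFormula (L^{k+1}·Mc)`, `Ew : TorusPieces F Mc k` with DEF-1's `Ψ.ResidueAtW … σ κ Φz`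
for the zero-input functional GIVEN the same objects at every `j < k` (Theorem 3's strong induction along the history), and, per input scale `E`, terms with `Ψ.ResidueAtW … (ρ·E) κ (Φf − Φz)`
under the signed inductive hypothesis; the frame `BalabanUVNodesPortS1.formatPlusG_recordJ_of_wrapAwareResidue` (PTA-1 ✓p802092) turns each residue into the signed `FormatPlusG` row.
ONE REGISTERED STUB `stub_zeroInputInductiveStepResidueW` = that door's hypothesis VERBATIM (namespaces opened; 5 778 ch < the 12 000-ch registry cap; the door's own binder is
15 150 ch fully qualified).  WHY ONE STUB AND NOT (Z)∕(L) SEPARATELY: the two residues live under ONE existential over `(γ₀, ε₂₉, σ, ρ, Ē, κ, α₀, α₁)`; `ε₂₉` enters the carriers through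
`thetaFill F a₀ ε₂₉` (no monotonicity) and `κ` is contravariant in (L)'s inductive hypothesis, so two independently quantified halves do NOT re-merge by a kernel seam — a (Z)∕(L) cut needs
a Φ-GENERIC one-step residue theorem (Thm 3's machine stated once over `IntLocalFormula.ResidueAtW`, then instantiated at `Φz` and at `Φf − Φz`), which is research typing beyond this
seat (card §«next cut»).  The direct twin `PortZDSplit.sig26648LR4_of_residueAtW` (no induction hypothesis for (Z)) is the alternative door for the same stub text minus the `∀ j < k` premise.

HONEST LABEL.  A REDUCTION skeleton = supply for hands, not progress: no `Ψ`, no `Ew` is constructed; neither residue is proved or claimed; ⟨26648⟩ SIGNED·OPEN (0∕1); ⟨27930⟩'s porter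
dockets untouched; NODE O not advanced; the route's `closes` reaches only the CONDITIONAL finite-𝕋⁴ rung `BalabanLadder.UV` (R4) at fixed `ε = L^(−K)`; NOT ℝ⁴ ∕ OS ∕ Clay — the Yang–Mills
mass gap is NOT proved by any of this.  [I] = Balaban1987RG1 (CMP 109): Thm 3 p.264, (1.6)–(1.9) p.261, (1.18)–(1.19) p.263, (2.12)–(2.13) p.268; [II] = Balaban1988RG2Cluster (CMP 116):
Lemma 3 (2.38) p.20, p.21.
-/

noncomputable section

open scoped BigOperators Matrix.Norms.L2Operator Topology
open Literature.MathematicalPhysics.QuantumFieldTheory.Balaban1983to89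
open Literature.MathematicalPhysics.QuantumFieldTheory.Balaban1983to89.Node00
open Literature.MathematicalPhysics.QuantumFieldTheory.Balaban1983to89.T4Continuum
open Summit.QuantumFields.YangMills.Theorems.K0RecordFormatNames

namespace Summit.QuantumFields.YangMills.Theses.BalabanUVNodes.PortZeroInputSplitZDSkeletonV1

/-! ## §1. The registered stub = the hypothesis of `PortZDSplit.sig26648LR4_of_zeroInputInductiveStepW`, VERBATIM (namespaces opened) -/

open scoped Classical in
/-- **stub (Z-step ∧ L-res, one object + free wrap pieces)** — under the signed port antecedent: the nine constant clauses ∧ (Z-step) `∀ k g, flow → interval → (∀ j < k, ∃ Ψ Ew,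
Ψ.ResidueAtW F Mc j Ew a₀ ε₂₉ α₀ α₁ σ κ Φz@j) → ∃ Ψ Ew, Ψ.ResidueAtW F Mc k Ew a₀ ε₂₉ α₀ α₁ σ κ Φz@k` ∧ (L-res) `∀ k g, flow → interval → ∀ E ∈ ]0, Ē], ⟨formats E of recordΦfAx at all
k₁ < k⟩ → ∃ Ψ Ew, Ψ.ResidueAtW F Mc k Ew a₀ ε₂₉ α₀ α₁ (ρ * E) κ (Φf − Φz)@k`.  RESEARCH∕PRINT-FAR: (Z) = [I] Thm 3's inductive step at zero input ([I] §2 with `𝐄_k := 0`);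
(L) = [II] Lemma 3's history activities; DEF-1's venue `IntLocalFormula.ResidueAtW` (ed. 13c ✓p801993).  Size L (two L-sized deliverables under one ∃). -/
theorem stub_zeroInputInductiveStepResidueW :
    ∀ F : T4Family, ∃ Mth : ℕ, ∀ Mc : ℕ, Mth ≤ Mc → ∀ (j c c₀ c₁ : ℕ) (B₃ B₃' a₀ a₁ : ℝ), McGuard F Mc → c ≤ F.L ^ j → c₀ ≤ j + 1 → c₁ ≤ j → 2 * (F.L : ℝ) ^ 2 ≤ B₃ → 0 < B₃' → 0 < a₀ → 0 < a₁ → VariationalThm1RegSepCoP7MGB F 2 (fun ν M g K k _s => c ≤ ν.M₁ ∧ k + c₀ ≤ F.m + K ∧ F.L ^ c₁ ∣ M ∧ ∀ i, 1 ≤ i → i ≤ k → dCubeSide (F.P K).L M (RkOfRecord (F.P K).L ν.r (g i)) i ∣ (F.P K).sitesPerDir 0) (lamDatum F) (dataSmall7LamTopOf F 2) B₃ a₀ a₁ → Gauge9RegSepTopStepGB F 2 (fun ν K Ω => suppDomOfRecord F ν K Ω) (F.L ^ j) (fun ν M g K k _s => c ≤ ν.M₁ ∧ k + c₀ ≤ F.m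 + K ∧ F.L ^ c₁ ∣ M ∧ ∀ i, 1 ≤ i → i ≤ k → dCubeSide (F.P K).L M (RkOfRecord (F.P K).L ν.r (g i)) i ∣ (F.P K).sitesPerDir 0) (lamDatum F) (dataSmall7LamTopOf F 2) B₃ B₃' a₀ a₁ → (∀ ε₁ : ℝ, 0 < ε₁ → ε₁ ≤ a₁ → B₃ * ε₁ ≤ a₀ → ∀ (k n : ℕ) (V : GaugeField (F.P (recordK₀ F Mc k + n)) (k + 1) (SU 2)), PlaqSmall ε₁ V → UkExists F 2 (recordK₀ F Mc k + n) (k + 1) a₀ V ∧ UniqueUkOrbit F 2 (recordK₀ F Mc k + n) (k + 1) a₀ V) → (∀ (k n : ℕ) (ε₂₉ : ℝ), 0 < ε₂₉ → letI θ := thetaFill F a₀ ε₂₉; letI := θ.instVβ₁; letI := θ.instVβ₂; letI := θ.instιβ; AnalyticAt ℝ (fun B : recordW F a₀ ε₂₉ k (recordK₀ F Mc k + n) => fun (b : PBond (F.P (recordK₀ F Mc k + n)) 0) (i i' : Fin 2) => ((recordBgField F θ k (recordK₀ F Mc k + n) B b : SU 2) : Matrix (Fin 2) (Fin 2) ℂ)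 i i') 0) → (∃ C₉' δ₉ : ℝ, 0 ≤ C₉' ∧ 0 < δ₉ ∧ ∀ (k n : ℕ) (ε₂₉ : ℝ), 0 < ε₂₉ → letI θ := thetaFill F a₀ ε₂₉; letI := θ.instVβ₁; letI := θ.instVβ₂; letI := θ.instιβ; ∀ (a : θ.ιβ) (μ : Fin (F.P (recordK₀ F Mc k + n)).d) (y : Site (F.P (recordK₀ F Mc k + n)) (k + 1)), letI D := fderiv ℝ (fun B : recordW F a₀ ε₂₉ k (recordK₀ F Mc k + n) => fun (b : PBond (F.P (recordK₀ F Mc k + n)) 0) (i i' : Fin 2) => ((recordBgField F θ k (recordK₀ F Mc k + n) B b : SU 2) : Matrix (Fin 2) (Fin 2) ℂ) i i') 0 (Pi.single μ (Pi.single y (θ.bV a))); ∃ (Hr : PBond (F.P (recordK₀ F Mc k + n)) 0 → Fin 2 → Fin 2 → ℂ) (φ : Site (F.P (recordK₀ F Mc k + n)) 0 → Fin 2 → Fin 2 → ℂ), (∀ b : PBond (F.P (recordK₀ F Mc k + n)) 0, D b = Hr b + (φ b.src - φ (b.src.shift b.dir))) ∧ (∃ μc : Site (F.P (recordK₀ F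 Mc k + n)) (k + 1) → Fin 2 → Fin 2 → ℂ, ∀ x : Site (F.P (recordK₀ F Mc k + n)) 0, letI dv := (fun x' : Site (F.P (recordK₀ F Mc k + n)) 0 => ∑ ν : Fin (F.P (recordK₀ F Mc k + n)).d, (Hr ⟨x', ν⟩ - Hr ⟨x'.unshift ν, ν⟩)); ∑ ν : Fin (F.P (recordK₀ F Mc k + n)).d, (dv (x.shift ν) - (2 : ℂ) • dv x + dv (x.unshift ν)) = μc (coarsenTo (k + 1) x)) ∧ ∀ b : PBond (F.P (recordK₀ F Mc k + n)) 0, ‖Hr b‖ ≤ C₉' * (F.P (recordK₀ F Mc k + n)).eta (k + 1) * Real.exp (-(δ₉ * (Site.tdist (coarsenTo (k + 1) b.src) y : ℝ))) ∧ (∀ ν : Fin (F.P (recordK₀ F Mc k + n)).d, ‖Hr (⟨b.src.shift ν, b.dir⟩ : PBond (F.P (recordK₀ F Mc k + n)) 0) - Hr b‖ ≤ C₉' * (F.P (recordK₀ F Mc k + n)).eta (k + 1) ^ 2 * Real.exp (-(δ₉ * (Site.tdist (coarsenTo (k + 1) b.src) y : ℝ)))) ∧ ‖∑ ν : Fin (F.P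 (recordK₀ F Mc k + n)).d, (Hr (⟨b.src.shift ν, b.dir⟩ : PBond (F.P (recordK₀ F Mc k + n)) 0) - (2 : ℂ) • Hr b + Hr (⟨b.src.unshift ν, b.dir⟩ : PBond (F.P (recordK₀ F Mc k + n)) 0))‖ ≤ C₉' * (F.P (recordK₀ F Mc k + n)).eta (k + 1) ^ 3 * Real.exp (-(δ₉ * (Site.tdist (coarsenTo (k + 1) b.src) y : ℝ))) ∧ ‖∑ ν : Fin (F.P (recordK₀ F Mc k + n)).d, ((Hr (⟨b.src, b.dir⟩ : PBond (F.P (recordK₀ F Mc k + n)) 0) + Hr (⟨(b.src).shift b.dir, ν⟩ : PBond (F.P (recordK₀ F Mc k + n)) 0) - Hr (⟨(b.src).shift ν, b.dir⟩ : PBond (F.P (recordK₀ F Mc k + n)) 0) - Hr (⟨b.src, ν⟩ : PBond (F.P (recordK₀ F Mc k + n)) 0)) - (Hr (⟨b.src.unshift ν, b.dir⟩ : PBond (F.P (recordK₀ F Mc k + n)) 0) + Hr (⟨(b.src.unshift ν).shift b.dir, ν⟩ : PBond (F.P (recordK₀ F Mc k + n)) 0) - Hr (⟨(b.src.unshift ν).shift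 ν, b.dir⟩ : PBond (F.P (recordK₀ F Mc k + n)) 0) - Hr (⟨b.src.unshift ν, ν⟩ : PBond (F.P (recordK₀ F Mc k + n)) 0)))‖ ≤ C₉' * (F.P (recordK₀ F Mc k + n)).eta (k + 1) ^ 3 * Real.exp (-(δ₉ * (Site.tdist (coarsenTo (k + 1) b.src) y : ℝ)))) → ∃ γ₀ ε₂₉ σ ρ Ē κ α₀ α₁ : ℝ, 0 < γ₀ ∧ 0 < ε₂₉ ∧ 0 < σ ∧ 0 ≤ ρ ∧ ρ < 1 ∧ σ ≤ (1 - ρ) * Ē ∧ 4 * B12TreeDecay.kappa₀ (4 * 2 ^ 4) (2 * 4) ≤ κ ∧ 0 < α₀ ∧ 0 < α₁ ∧ (∀ k : ℕ, ∀ g : ℕ → ℝ, FlowStep.RGEqH k (betaOfRecord₁₃Ax F 2 (thetaFill F a₀ ε₂₉)) g → Step.InInterval γ₀ k g → (∀ j, j < k → ∃ (Ψ : IntLocalFormula (F.L ^ (j + 1) * Mc)) (Ew : TorusPieces F Mc j), Ψ.ResidueAtW F Mc j Ew a₀ ε₂₉ α₀ α₁ σ κ (fun n => recordΦzAx F a₀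 ε₂₉ j (FlowStep.prefixOf g j) (recordK₀ F Mc j + n))) → ∃ (Ψ : IntLocalFormula (F.L ^ (k + 1) * Mc)) (Ew : TorusPieces F Mc k), Ψ.ResidueAtW F Mc k Ew a₀ ε₂₉ α₀ α₁ σ κ (fun n => recordΦzAx F a₀ ε₂₉ k (FlowStep.prefixOf g k) (recordK₀ F Mc k + n))) ∧ ∀ k : ℕ, ∀ g : ℕ → ℝ, FlowStep.RGEqH k (betaOfRecord₁₃Ax F 2 (thetaFill F a₀ ε₂₉)) g → Step.InInterval γ₀ k g → ∀ E : ℝ, 0 < E → E ≤ Ē → (∀ k₁ : ℕ, k₁ < k → letI θ := thetaFill F a₀ ε₂₉; letI := θ.instVβ₁; letI := θ.instVβ₂; letI := θ.instιβ; B12FormatPlus.FormatPlusG (fun n => recordDomSys F Mc k₁ (recordK₀ F Mc k₁ + n)) (fun n => recordBondCount F (recordK₀ F Mc k₁ + n)) (fun n => recordAct F (recordK₀ F Mc k₁ + n)) (fun n => recordUc F Mc k₁ α₀ α₁ (recordK₀ F Mc k₁ + n)) (fun n => recordCoords F Mc k₁ (recordK₀ F Mc k₁ + n)) (fun n => recordChartDimJ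 F (recordK₀ F Mc k₁ + n)) (fun n => recordChartJ F Mc k₁ (recordK₀ F Mc k₁ + n)) (fun n => recordΦfAx F a₀ ε₂₉ k₁ (FlowStep.prefixOf g k₁) (recordK₀ F Mc k₁ + n)) (fun n => recordEmbJ F θ k₁ (recordK₀ F Mc k₁ + n)) (fun n => recordWrapCtr F Mc k₁ (recordK₀ F Mc k₁ + n)) (fun n => recordDomEmbCtr F Mc k₁ (recordK₀ F Mc k₁ + n)) (fun n _ => recordCoordProjCtr F (recordK₀ F Mc k₁ + n)) E κ) → ∃ (Ψ : IntLocalFormula (F.L ^ (k + 1) * Mc)) (Ew : TorusPieces F Mc k), Ψ.ResidueAtW F Mc k Ew a₀ ε₂₉ α₀ α₁ (ρ * E) κ (fun n B => recordΦfAx F a₀ ε₂₉ k (FlowStep.prefixOf g k) (recordK₀ F Mc k + n) B - recordΦzAx F a₀ ε₂₉ k (FlowStep.prefixOf g k) (recordK₀ F Mc k + n) B) := by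
  sorry

/-! ## §2. Composition BY NAME (PTZ-1's door; the frame twice + strong induction, sorry-free in the tree) -/

/-- **★ THE SKELETON THEOREM — `PortZeroInputSplitZD` from the one registered stub** through `PortZDSplit.sig26648LR4_of_zeroInputInductiveStepW` (the ONLY theorem of this file
concluding the crux BY NAME; no `sorry` here; the door's conclusion is the signed text, definitionally the route decl). -/
theorem portZeroInputSplitZD_of_stub : Summit.QuantumFields.YangMills.Theses.BalabanUVNodes.PortZeroInputSplitZD :=
  Summit.QuantumFields.YangMills.Theorems.PortZDSplit.sig26648LR4_of_zeroInputInductiveStepW stub_zeroInputInductiveStepResidueW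

end Summit.QuantumFields.YangMills.Theses.BalabanUVNodes.PortZeroInputSplitZDSkeletonV1

end
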